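import Literature.AlgebraicGeometry.Resolution.PermissibleBlowupHilbertSamuel
import Literature.AlgebraicGeometry.Resolution.StalkIdealGenerization
import Literature.RingTheory.HilbertSamuel.PhiUpperBound
import HarnessLib

/-!
# The fibres of a permissible blow-up: `dim_{x'} π⁻¹(x) ≤ dim 𝒪_{X,x} − dim 𝒪_{D,x} − 1`
# (CJS LNM 2270, proof of Thm. 3.10: `F = π⁻¹(x) = Proj(A)`, `A` the fibre cone; char-free)

Topic: `Literature/AlgebraicGeometry/Resolution`. Let `π : X' → X` be a blow-up (`IsBlowup π D`) of a
locally Noetherian scheme in a centre `D` which is PERMISSIBLE at `x = π x'` (CJS Def. 3.1: `D` regular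
at `x`, `X` normally flat along `D` at `x`). Cossart–Jannsen–Saito, *Desingularization: Invariants and
Strategy*, LNM 2270 (2020), proof of Thm. 3.10 (p. 46): "let `A = gr_𝔭(𝒪_{X,x}) ⊗_{𝒪/𝔭} k(x)`, and let
`F = π_X⁻¹(x) ⊂ X'` be the scheme theoretic fibre … Then `F = Proj(A)` … `C_{X,D,x} = Spec(A)`", with
Thm. 3.3 / HIO (31.1): along a permissible centre `H^{(1+s)}_{C_{X,D,x}} = H^{(1)}_{𝒪_{X,x}}`,
`s = dim 𝒪_{D,x}`, so that `dim A = dim 𝒪_{X,x} − dim 𝒪_{D,x}` and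
**`dim F = dim A − 1 = dim 𝒪_{X,x} − dim 𝒪_{D,x} − 1`** — e.g. the exceptional divisor over a
permissible SURFACE in a threefold is FINITE over the surface. This file PROVES the local form of this
dimension bound at every point `x'` of the fibre, in every characteristic, from the tree's fibre-cone
kit (`FibreCone.lean`: `hilbertSamuelFun_fibreConeLocal_add_le`; `BlowupFibreConeModel.lean`:
`length_succ_le_ringKrullDim_fibreConeLocal_quotient`) and CJS Lemma 2.25 (b)
(`ringKrullDim_add_le_of_hilbertSamuelFun_le`):

* `length_succ_le_ringKrullDim_fibreConeLocal` — a strict chain of primes of the chart ring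
  `𝒞 = 𝒪[𝔭t]_{(at)}` lying over `𝔫` (points of the fibre) has length `+ 1 ≤ dim A_𝔐`;
* `ringKrullDim_quotient_map_maximalIdeal_succ_le` — for `𝒪' = 𝒞_P`, `P` over `𝔫`:
  **`dim 𝒪'/𝔫𝒪' + 1 ≤ dim A_𝔐`** (the local ring of the fibre at `x'` has dimension `≤ dim A − 1`);
* `ringKrullDim_quotient_map_maximalIdeal_add_le` — **`dim 𝒪'/𝔫𝒪' + dim 𝒪/𝔭 + 1 ≤ dim 𝒪`** for
  `𝔭` permissible (`𝒪/𝔭` regular, `𝔭` normally flat): `dim A_𝔐 + dim 𝒪/𝔭 ≤ dim 𝒪` by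
  `H^{(s)}[A_𝔐] ≤ H^{(0)}[𝒪]` and Lemma 2.25 (b);
* `IsBlowup.ringKrullDim_stalk_quotient_map_maximalIdeal_add_le` — on the blow-up:
  **`dim (𝒪_{X',x'}/𝔪_x𝒪_{X',x'}) + dim 𝒪_{D,x} + 1 ≤ dim 𝒪_{X,x}`** for `D` permissible at `x = π x'`;
* `IsBlowup.eq_of_specializes_of_base_eq` — **the fibre is DISCRETE when `dim 𝒪_{X,x} ≤ dim 𝒪_{D,x} + 1`**:
  a generisation `z' ⤳ x'` with `π z' = π x'` equals `x'` (no two points of the fibre over `x`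
  specialise to one another; e.g. over a permissible surface through a point of a threefold).

No characteristic hypothesis (contrast CJS Thm. 3.14, which places the NEAR points in `ℙ(Dir_x/T_x D)`).
No definitions, no named facts. Consumer: the Hironaka campaign's W4.2 line (res-type-040's binder
`StrataDepthDiscipline`, conjunct (a) «moving births are curves»).

## Sources

* V. Cossart, U. Jannsen, S. Saito, LNM 2270 (2020), proof of Thm. 3.10 (p. 46), Thm. 3.3, Lemma 2.25 (b),
  Def. 3.1. [CossartJannsenSaito2020]
* M. Herrmann, S. Ikeda, U. Orbanz, *Equimultiplicity and Blowing up* (1988), (31.1). [HerrmannIkedaOrbanz1988]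
* The Stacks Project, Tags 0804, 01J7. [StacksProject]
-/

noncomputable section

open CategoryTheory AlgebraicGeometry TopologicalSpace IsLocalRing Order
open Literature.RingTheory.HilbertSamuel

namespace Literature.AlgebraicGeometry.Resolution

universe u

/-! ## Ring level: the fibre of `Bl_𝔭(Spec 𝒪) → Spec 𝒪` over the closed point, read on a chart -/

section Chart

variable {O : Type u} [CommRing O] [IsLocalRing O] [IsNoetherianRing O] {𝔭 : Ideal O} (a : O) (ha : a ∈ 𝔭)

local notation3 "𝒞" => HomogeneousLocalization.Away (reesGrading 𝔭) (reesT a ha)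

omit [IsNoetherianRing O] in
/-- **Chains in the fibre are shorter than the cone is high**: a strict chain of primes of the chart
ring `𝒞 = 𝒪[𝔭t]_{(at)}` whose first member lies over `𝔫` (so that all of them do: points of the fibre
`F = Proj(A)` specialising to one another) has length `+ 1 ≤ dim A_𝔐`, the dimension of the local ring of
the fibre cone at its vertex. [cite: CossartJannsenSaito2020, Thm. 3.10 (proof, p. 46)] -/
theorem length_succ_le_ringKrullDim_fibreConeLocal (t : LTSeries (PrimeSpectrum 𝒞))
    (ht : t.head.asIdeal.comap (reesChartBase a ha) = maximalIdeal O) :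
    ((t.length + 1 : ℕ) : WithBot ℕ∞) ≤ ringKrullDim (FibreConeLocal 𝔭) :=
  (length_succ_le_ringKrullDim_fibreConeLocal_quotient a ha t.head.asIdeal ht t rfl).trans
    (ringKrullDim_quotient_le _)

/-- **The local ring of the fibre at a point has dimension `≤ dim A_𝔐 − 1`**: for `𝒪' = 𝒞_P` the
local ring of the blowing up at a point `P` over `𝔫`, `dim 𝒪'/𝔫𝒪' + 1 ≤ dim A_𝔐` (the primes of
`𝒪'/𝔫𝒪'` are the primes `𝔫𝒞 ⊆ Q ⊆ P` of the chart; apply the chain bound to chains of them).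
[cite: CossartJannsenSaito2020, Thm. 3.10 (proof, p. 46)] -/
theorem ringKrullDim_quotient_map_maximalIdeal_succ_le (P : Ideal 𝒞) [P.IsPrime]
    (hP : P.comap (reesChartBase a ha) = maximalIdeal O) (O' : Type u) [CommRing O'] [Algebra 𝒞 O']
    [IsLocalization.AtPrime O' P] :
    ringKrullDim (O' ⧸ (maximalIdeal O).map ((algebraMap 𝒞 O').comp (reesChartBase a ha))) + 1 ≤
      ringKrullDim (FibreConeLocal 𝔭) := by
  set φ' : O →+* O' := (algebraMap 𝒞 O').comp (reesChartBase a ha) with hφ'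
  set I : Ideal O' := (maximalIdeal O).map φ' with hI
  -- `dim A_𝔐 = d < ∞`
  obtain ⟨d, hd⟩ : ∃ d : ℕ, ringKrullDim (FibreConeLocal 𝔭) = d :=
    exists_nat_eq_of_ne_bot_of_ne_top ringKrullDim_ne_bot ringKrullDim_ne_top
  rw [hd, ringKrullDim_quotient]
  -- every chain in `V(I) ⊆ Spec 𝒪'` has length `+ 1 ≤ d`
  have hcomap_inj : Function.Injective
      (fun Q : PrimeSpectrum O' => (⟨Q.asIdeal.comap (algebraMap 𝒞 O'), inferInstance⟩ : PrimeSpectrum 𝒞)) := by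
    intro Q Q' h
    have h' : Q.asIdeal.comap (algebraMap 𝒞 O') = Q'.asIdeal.comap (algebraMap 𝒞 O') :=
      congrArg PrimeSpectrum.asIdeal h
    ext1
    rw [← IsLocalization.map_under P.primeCompl O' Q.asIdeal, ← IsLocalization.map_under P.primeCompl O' Q'.asIdeal,
      Ideal.under_def, Ideal.under_def, h']
  have hmono : StrictMono
      (fun Q : PrimeSpectrum.zeroLocus (R := O') (I : Set O') =>
        (⟨Q.1.asIdeal.comap (algebraMap 𝒞 O'), inferInstance⟩ : PrimeSpectrum 𝒞)) := by
    refine Monotone.strictMono_of_injective (fun Q Q' h => Ideal.comap_mono h) ?_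
    intro Q Q' h
    exact Subtype.ext (hcomap_inj h)
  have hchain : ∀ p : LTSeries (PrimeSpectrum.zeroLocus (R := O') (I : Set O')), (p.length : ℕ∞) + 1 ≤ d := by
    intro p
    let t : LTSeries (PrimeSpectrum 𝒞) := p.map _ hmono
    have hthead : t.head.asIdeal.comap (reesChartBase a ha) = maximalIdeal O := by
      -- `t.head ⊇ 𝔫𝒞` and is proper
      have hle : maximalIdeal O ≤ t.head.asIdeal.comap (reesChartBase a ha) := by
        intro r hr
        rw [LTSeries.head_map]
        change reesChartBase a ha r ∈ (p.head.1.asIdeal.comap (algebraMap 𝒞 O'))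
        rw [Ideal.mem_comap]
        have hmem : φ' r ∈ I := Ideal.mem_map_of_mem _ hr
        exact p.head.2 hmem
      haveI : (t.head.asIdeal.comap (reesChartBase a ha)).IsPrime := Ideal.comap_isPrime _ _
      exact ((IsLocalRing.maximalIdeal.isMaximal O).eq_of_le (Ideal.IsPrime.ne_top inferInstance) hle).symm
    have key := length_succ_le_ringKrullDim_fibreConeLocal a ha t hthead
    rw [hd] at key
    have hlen : t.length = p.length := by simp [t]
    rw [hlen] at key
    have key' : ((p.length + 1 : ℕ) : ℕ∞) ≤ d := by exact_mod_cast key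
    exact_mod_cast key'
  -- hence `krullDim V(I) + 1 ≤ d`
  haveI : Nonempty (PrimeSpectrum.zeroLocus (R := O') (I : Set O')) := by
    haveI : IsLocalRing O' := IsLocalization.AtPrime.isLocalRing O' P
    have hIle : I ≤ maximalIdeal O' := by
      rw [hI, Ideal.map_le_iff_le_comap]
      intro r hr
      rw [Ideal.mem_comap]
      have h1 : reesChartBase a ha r ∈ P := by rw [← Ideal.mem_comap, hP]; exact hr
      have h2 : φ' r ∈ P.map (algebraMap 𝒞 O') := Ideal.mem_map_of_mem _ h1
      rwa [IsLocalization.AtPrime.map_eq_maximalIdeal P O'] at h2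
    exact ⟨⟨⟨maximalIdeal O', inferInstance⟩, hIle⟩⟩
  have hd1 : 1 ≤ d := by
    have h0 := hchain (RelSeries.singleton _ (Classical.arbitrary _))
    simp only [RelSeries.singleton_length, Nat.cast_zero, zero_add] at h0
    exact_mod_cast h0
  have h1 : ∀ p : LTSeries (PrimeSpectrum.zeroLocus (R := O') (I : Set O')), (p.length : ℕ∞) ≤ ((d - 1 : ℕ) : ℕ∞) := by
    intro p
    have h := hchain p
    have h' : p.length + 1 ≤ d := by exact_mod_cast h
    exact_mod_cast (by omega : p.length ≤ d - 1)
  have h2 : krullDim (PrimeSpectrum.zeroLocus (R := O') (I : Set O')) ≤ ((d - 1 : ℕ) : WithBot ℕ∞) := by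
    rw [krullDim_eq_iSup_length]
    have h2' : ((⨆ p : LTSeries (PrimeSpectrum.zeroLocus (R := O') (I : Set O')), (p.length : ℕ∞) : ℕ∞) : WithBot ℕ∞) ≤
        (((d - 1 : ℕ) : ℕ∞) : WithBot ℕ∞) :=
      WithBot.coe_le_coe.mpr (iSup_le h1)
    rwa [WithBot.coe_natCast] at h2'
  calc krullDim (PrimeSpectrum.zeroLocus (R := O') (I : Set O')) + 1 ≤ ((d - 1 : ℕ) : WithBot ℕ∞) + 1 :=
        add_le_add h2 le_rfl
    _ = (d : WithBot ℕ∞) := by norm_cast; omega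

/-- **`dim 𝒪'/𝔫𝒪' + dim 𝒪/𝔭 + 1 ≤ dim 𝒪` along a permissible centre** (`𝒪/𝔭` regular of dimension `s`,
`𝔭` normally flat): the local rings `𝒪' = 𝒞_P` of the blowing up at the points over the closed point have
fibre dimension `dim 𝒪'/𝔫𝒪' ≤ dim 𝒪 − s − 1` — with `H^{(s)}[A_𝔐] ≤ H^{(0)}[𝒪]` (normal flatness + Bennett,
`hilbertSamuelFun_fibreConeLocal_add_le`) and CJS Lemma 2.25 (b) (`dim A_𝔐 + s ≤ dim 𝒪`). Char-free.
[cite: CossartJannsenSaito2020, Thm. 3.10 (proof, p. 46)] [cite: CossartJannsenSaito2020, Lemma 2.25 (b)] -/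
theorem ringKrullDim_quotient_map_maximalIdeal_add_le [𝔭.IsPrime] [IsRegularLocalRing (O ⧸ 𝔭)] {s : ℕ}
    (hs : ringKrullDim (O ⧸ 𝔭) = s) (hNF : 𝔭.IsNormallyFlat) (P : Ideal 𝒞) [P.IsPrime]
    (hP : P.comap (reesChartBase a ha) = maximalIdeal O) (O' : Type u) [CommRing O'] [Algebra 𝒞 O']
    [IsLocalization.AtPrime O' P] :
    ringKrullDim (O' ⧸ (maximalIdeal O).map ((algebraMap 𝒞 O').comp (reesChartBase a ha))) + ((s + 1 : ℕ) : WithBot ℕ∞) ≤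
      ringKrullDim O := by
  have hA : ringKrullDim (FibreConeLocal 𝔭) + ((0 + s : ℕ) : WithBot ℕ∞) ≤ ringKrullDim O + ((0 : ℕ) : WithBot ℕ∞) :=
    ringKrullDim_add_le_of_hilbertSamuelFun_le O (hilbertSamuelFun_fibreConeLocal_add_le 𝔭 hs hNF 0)
  simp only [zero_add, Nat.cast_zero, add_zero] at hA
  have hF := ringKrullDim_quotient_map_maximalIdeal_succ_le a ha P hP O'
  calc ringKrullDim (O' ⧸ (maximalIdeal O).map ((algebraMap 𝒞 O').comp (reesChartBase a ha))) + ((s + 1 : ℕ) : WithBot ℕ∞)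
      = (ringKrullDim (O' ⧸ (maximalIdeal O).map ((algebraMap 𝒞 O').comp (reesChartBase a ha))) + 1) + (s : WithBot ℕ∞) := by
        push_cast; ring
    _ ≤ ringKrullDim (FibreConeLocal 𝔭) + (s : WithBot ℕ∞) := add_le_add hF le_rfl
    _ ≤ ringKrullDim O := by exact_mod_cast hA

end Chart

/-! ## On a blowing up -/

section Scheme

variable {X X' : Scheme.{u}} {π : X' ⟶ X} {D : X.IdealSheafData}

/-- **THE FIBRE OF A PERMISSIBLE BLOW-UP: `dim (𝒪_{X',x'}/𝔪_x 𝒪_{X',x'}) + dim 𝒪_{D,x} + 1 ≤ dim 𝒪_{X,x}`.**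
Let `X` be locally Noetherian, `π : X' → X` a blow-up in `D`, `x' ∈ X'` with `x = π x'`, `D` permissible
at `x` (CJS Def. 3.1) and `dim 𝒪_{D,x} = dim 𝒪_{X,x}/D_x = s`. Then the local ring at `x'` of the fibre
`π⁻¹(x)` has dimension `≤ dim 𝒪_{X,x} − s − 1` (the fibre is `Proj` of the fibre cone `A`,
`dim A = dim 𝒪_{X,x} − s`). Every characteristic; every point of the fibre (closed or not).
[cite: CossartJannsenSaito2020, Thm. 3.10 (proof, p. 46)] -/
theorem IsBlowup.ringKrullDim_stalk_quotient_map_maximalIdeal_add_le [IsLocallyNoetherian X]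
    (hπ : IsBlowup π D) (x' : X') (hperm : IdealSheafData.IsPermissibleAt D (π.base x')) {s : ℕ}
    (hs : ringKrullDim (X.presheaf.stalk (π.base x') ⧸ stalkIdeal D (π.base x')) = s) :
    ringKrullDim (X'.presheaf.stalk x' ⧸
        (maximalIdeal (X.presheaf.stalk (π.base x'))).map (π.stalkMap x').hom) + ((s + 1 : ℕ) : WithBot ℕ∞) ≤
      ringKrullDim (X.presheaf.stalk (π.base x')) := by
  classical
  obtain ⟨k, c, hc⟩ := Submodule.fg_iff_exists_fin_generating_family.mp
    (IsNoetherian.noetherian (stalkIdeal D (π.base x')))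
  obtain ⟨j, 𝔴, χ, hχ, hloc, h𝔴⟩ := hπ.exists_reesChart_stalk x' c hc
  letI algCO : Algebra (chartRing c j) (X'.presheaf.stalk x') := χ.toAlgebra
  haveI : IsLocalization.AtPrime (X'.presheaf.stalk x') 𝔴.asIdeal := hloc
  -- permissibility of `J_x = (c_1, …, c_k)`
  have hc' : Ideal.span (Set.range c) = stalkIdeal D (π.base x') := hc
  have hp : (Ideal.span (Set.range c)).IsPermissible := by rw [hc']; exact hperm
  haveI : IsRegularLocalRing (X.presheaf.stalk (π.base x') ⧸ Ideal.span (Set.range c)) := hp.1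
  haveI : IsDomain (X.presheaf.stalk (π.base x') ⧸ Ideal.span (Set.range c)) :=
    isDomain_of_isRegularLocalRing _
  haveI : (Ideal.span (Set.range c)).IsPrime :=
    (Ideal.Quotient.isDomain_iff_prime _).mp inferInstance
  have hs' : ringKrullDim (X.presheaf.stalk (π.base x') ⧸ Ideal.span (Set.range c)) = s := by
    rw [hc']; exact hs
  have hcj : c j ∈ Ideal.span (Set.range c) := Ideal.mem_span_range_self (f := c) (x := j)
  have key := ringKrullDim_quotient_map_maximalIdeal_add_le (c j) hcj hs' hp.2.1 𝔴.asIdeal h𝔴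
    (X'.presheaf.stalk x')
  have hφ : ((algebraMap (chartRing c j) (X'.presheaf.stalk x')).comp (reesChartBase (c j) hcj)) =
      (π.stalkMap x').hom := RingHom.ext fun r => hχ r
  rw [hφ] at key
  exact key

/-- **THE FIBRE IS DISCRETE WHEN `dim 𝒪_{X,x} ≤ dim 𝒪_{D,x} + 1`** (e.g. over a permissible surface
through a point of a threefold): for `z' ⤳ x'` in `X'` with `π z' = π x' = x`, `D` permissible at `x`,
`dim 𝒪_{X,x}/D_x = s` and `dim 𝒪_{X,x} ≤ s + 1`, we have `z' = x'` — the fibre local ring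
`𝒪_{X',x'}/𝔪_x𝒪_{X',x'}` has dimension `0`, and the prime `𝔭_{z'} ⊆ 𝒪_{X',x'}` of the generisation
`z'` contains `𝔪_x𝒪_{X',x'}` (`(π^♯)⁻¹𝔭_{z'} = 𝔭_{π z'} = 𝔭_x = 𝔪_x`), so it is the maximal ideal.
[cite: CossartJannsenSaito2020, Thm. 3.10 (proof, p. 46)] [cite: StacksProject, Tag 01J7] -/
theorem IsBlowup.eq_of_specializes_of_base_eq [IsLocallyNoetherian X] (hπ : IsBlowup π D) {z' x' : X'}
    (hz : z' ⤳ x') (hπz : π.base z' = π.base x') (hperm : IdealSheafData.IsPermissibleAt D (π.base x'))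
    {s : ℕ} (hs : ringKrullDim (X.presheaf.stalk (π.base x') ⧸ stalkIdeal D (π.base x')) = s)
    (hdim : ringKrullDim (X.presheaf.stalk (π.base x')) ≤ ((s + 1 : ℕ) : WithBot ℕ∞)) : z' = x' := by
  set O' := X'.presheaf.stalk x' with hO'
  set I : Ideal O' := (maximalIdeal (X.presheaf.stalk (π.base x'))).map (π.stalkMap x').hom with hI
  -- the fibre local ring has dimension `≤ 0`
  have hfib : ringKrullDim (O' ⧸ I) ≤ 0 := by
    have key := hπ.ringKrullDim_stalk_quotient_map_maximalIdeal_add_le x' hperm hs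
    have key' : ringKrullDim (O' ⧸ I) + ((s + 1 : ℕ) : WithBot ℕ∞) ≤ 0 + ((s + 1 : ℕ) : WithBot ℕ∞) := by
      rw [zero_add]; exact key.trans hdim
    -- cancel the finite summand (`𝒪'/I` is non-trivial: `I ⊆ 𝔪'` as `π^♯` is local)
    have hIle' : I ≤ maximalIdeal O' := by
      rw [hI, Ideal.map_le_iff_le_comap]
      intro r hr
      exact map_nonunit (π.stalkMap x').hom r hr
    haveI : Nontrivial (O' ⧸ I) :=
      Ideal.Quotient.nontrivial_iff.mpr (ne_top_of_le_ne_top (Ideal.IsPrime.ne_top inferInstance) hIle')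
    obtain ⟨e, he⟩ : ∃ e : ℕ∞, ringKrullDim (O' ⧸ I) = e := by
      obtain ⟨e, he⟩ := WithBot.ne_bot_iff_exists.mp
        (ne_bot_of_le_ne_bot WithBot.coe_ne_bot (ringKrullDim_nonneg_of_nontrivial (R := O' ⧸ I)))
      exact ⟨e, he.symm⟩
    rw [he] at key' ⊢
    have h2 : e + ((s + 1 : ℕ) : ℕ∞) ≤ 0 + ((s + 1 : ℕ) : ℕ∞) := by exact_mod_cast key'
    have h3 : e ≤ 0 := (ENat.add_le_add_iff_right (ENat.coe_ne_top _)).mp h2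
    exact_mod_cast h3
  -- the prime of `z'` in `𝒪'` contains `I`
  have hcomap : (primeOfSpecializes hz).comap (π.stalkMap x').hom = maximalIdeal (X.presheaf.stalk (π.base x')) := by
    have hnat : (primeOfSpecializes hz).comap (π.stalkMap x').hom =
        primeOfSpecializes (hz.map π.continuous : π.base z' ⤳ π.base x') := by
      change ((maximalIdeal (X'.presheaf.stalk z')).comap (X'.presheaf.stalkSpecializes hz).hom).comap
          (π.stalkMap x').hom =
        (maximalIdeal (X.presheaf.stalk (π.base z'))).comap
          (X.presheaf.stalkSpecializes (hz.map π.continuous)).hom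
      rw [← IsLocalRing.maximalIdeal_comap (π.stalkMap z').hom, Ideal.comap_comap, Ideal.comap_comap,
        ← CommRingCat.hom_comp, ← CommRingCat.hom_comp, Scheme.Hom.stalkSpecializes_stalkMap]
    rw [hnat]
    have gen : ∀ (y : X) (hy : y ⤳ π.base x'), y = π.base x' →
        primeOfSpecializes hy = maximalIdeal (X.presheaf.stalk (π.base x')) := by
      rintro y hy rfl
      change (maximalIdeal _).comap (X.presheaf.stalkSpecializes (specializes_refl _)).hom = _
      rw [TopCat.Presheaf.stalkSpecializes_refl]
      exact Ideal.comap_id _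
    exact gen _ _ hπz
  have hIle : I ≤ primeOfSpecializes hz := by
    rw [hI, Ideal.map_le_iff_le_comap, hcomap]
  -- so `𝔭_{z'} = 𝔪'` (a chain `𝔭_{z'} < 𝔪'` in `V(I)` would have length `1 > 0`)
  have heq : primeOfSpecializes hz = maximalIdeal O' := by
    by_contra hne
    have hlt : primeOfSpecializes hz < maximalIdeal O' :=
      lt_of_le_of_ne (le_maximalIdeal (Ideal.IsPrime.ne_top inferInstance)) hne
    let q₀ : PrimeSpectrum.zeroLocus (R := O') (I : Set O') := ⟨⟨primeOfSpecializes hz, inferInstance⟩, hIle⟩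
    let q₁ : PrimeSpectrum.zeroLocus (R := O') (I : Set O') :=
      ⟨⟨maximalIdeal O', inferInstance⟩, hIle.trans hlt.le⟩
    have hq : q₀ < q₁ := hlt
    have h1 : ((1 : ℕ) : WithBot ℕ∞) ≤ krullDim (PrimeSpectrum.zeroLocus (R := O') (I : Set O')) :=
      le_krullDim_iff.mpr ⟨(RelSeries.singleton _ q₀).snoc q₁ hq, by simp⟩
    rw [← ringKrullDim_quotient] at h1
    exact (not_le.mpr zero_lt_one) (by exact_mod_cast h1.trans hfib : (1 : WithBot ℕ∞) ≤ 0)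
  -- and `z' = x'`
  have h1 : X'.fromSpecStalk x' ⟨primeOfSpecializes hz, inferInstance⟩ = z' :=
    Literature.AlgebraicGeometry.Motives.fromSpecStalk_comap_maximalIdeal hz
  have h2 : X'.fromSpecStalk x' ⟨maximalIdeal O', inferInstance⟩ = x' := Scheme.fromSpecStalk_closedPoint
  calc z' = X'.fromSpecStalk x' ⟨primeOfSpecializes hz, inferInstance⟩ := h1.symm
    _ = X'.fromSpecStalk x' ⟨maximalIdeal O', inferInstance⟩ :=
        congrArg (fun q => (X'.fromSpecStalk x').base q) (PrimeSpectrum.ext heq)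
    _ = x' := h2

end Scheme

end Literature.AlgebraicGeometry.Resolution

end
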